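import Mathlib
import HarnessLib
import Literature.Analysis.SpecialFunctions.GammaStirlingUniform

/-!
# ζ(5) search — a uniform vertical ratio bound `‖Γ(w)‖ ≤ C ‖w+d‖^{−d} ‖Γ(w+d)‖` on `Re w ≥ x₀` (cell `pub-zeta5`, ct-1 g28)

HONEST FRAMING: systematic search; no irrationality claim unless kernel-certified.  An estimate for a special function (Stirling,
uniform on a right half-plane); nothing here is an irrationality result, a worthiness exponent or a denominator statement; no named
fact is discharged; no definition is introduced.

Brick B6b of `HOME/ct-1/g28/VWP-BLUEPRINT-g28.md` (the corrected induction step of Zudilin math/0206177 peels the FIRST variable and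
swaps `Σ_μ` with a Barnes `t`-integral; the joint majorant needs the two-variable decay of `Γ(μ−t)/Γ(1+h₀+μ+t)` in `(μ, Im t)`,
with `μ` UNBOUNDED — beyond the compact-range Stirling of `GammaStirlingVertical`).  From the Literature's PROVED uniform Stirling
formula `GammaStirlingUniform.abs_log_norm_Gamma_sub_le` (error `≤ (1/12)(1/‖w‖² + π/(2‖w‖))` on `Re w > 0`):

* `norm_le_norm_add_ofReal`, `im_mul_arg_sub_arg_nonneg` — same ordinate, larger real part: `‖w‖ ≤ ‖w+d‖` and
  `Im w · (arg w − arg(w+d)) ≥ 0` (the argument terms of the two Stirling main terms compare with the RIGHT sign);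
* `re_mul_log_sub_log_le` — `(Re w − ½)(log‖w‖ − log‖w+d‖) ≤ d/(2x₀)`;
* **`exists_norm_Gamma_le_rpow_mul`** — for `x₀ > 0`, `d ≥ 0` there is `C > 0` with `‖Γ(w)‖ ≤ C ‖w+d‖^{−d} ‖Γ(w+d)‖` for ALL `w` with
  `Re w ≥ x₀`; `exists_norm_Gamma_div_le` (ratio form), `exists_norm_Gamma_conj_div_le` (conjugate ordinate in the numerator:
  `‖Γ(x−iy)/Γ(x+d+iy)‖ ≤ C‖x+d+iy‖^{−d}`, the shape met in the induction step).

Theorems only; imports `Literature.Analysis.SpecialFunctions.GammaStirlingUniform` (proved).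
-/

noncomputable section

namespace Summit.KontsevichZagierPeriods.Zeta5Search.GammaRatioUniform

open scoped Real
open Literature.Analysis.SpecialFunctions.GammaStirling (abs_log_norm_Gamma_sub_le)

/-! ### 1. Same ordinate, larger real part -/

/-- `‖w‖ ≤ ‖w + d‖` for `Re w ≥ 0` and real `d ≥ 0`. -/
theorem norm_le_norm_add_ofReal {w : ℂ} (hw : 0 ≤ w.re) {d : ℝ} (hd : 0 ≤ d) : ‖w‖ ≤ ‖w + d‖ := by
  have h1 : ‖w‖ ^ 2 ≤ ‖w + d‖ ^ 2 := by
    rw [Complex.sq_norm, Complex.sq_norm, Complex.normSq_apply, Complex.normSq_apply]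
    simp only [Complex.add_re, Complex.ofReal_re, Complex.add_im, Complex.ofReal_im, add_zero]
    nlinarith
  exact le_of_pow_le_pow_left₀ two_ne_zero (norm_nonneg _) h1

/-- `‖w + d‖ ≤ ‖w‖ + d` for real `d ≥ 0`. -/
theorem norm_add_ofReal_le (w : ℂ) {d : ℝ} (hd : 0 ≤ d) : ‖w + d‖ ≤ ‖w‖ + d := by
  calc ‖w + d‖ ≤ ‖w‖ + ‖(d : ℂ)‖ := norm_add_le _ _
    _ = ‖w‖ + d := by rw [Complex.norm_real, Real.norm_eq_abs, abs_of_nonneg hd]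

/-- **The argument terms compare with the right sign**: `Im w · (arg w − arg(w + d)) ≥ 0` for `Re w > 0`, `d ≥ 0`
(on `Re ≥ 0`, `arg = arcsin(Im/‖·‖)` and `‖w‖ ≤ ‖w+d‖`). -/
theorem im_mul_arg_sub_arg_nonneg {w : ℂ} (hw : 0 < w.re) {d : ℝ} (hd : 0 ≤ d) :
    0 ≤ w.im * (Complex.arg w - Complex.arg (w + d)) := by
  have hn : ‖w‖ ≤ ‖w + d‖ := norm_le_norm_add_ofReal hw.le hd
  have h0 : 0 < ‖w‖ := norm_pos_iff.mpr fun h => by rw [h] at hw; simp at hw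
  rw [Complex.arg_of_re_nonneg hw.le, Complex.arg_of_re_nonneg (by simp; linarith)]
  simp only [Complex.add_im, Complex.ofReal_im, add_zero]
  rcases le_or_gt 0 w.im with hy | hy
  · have : w.im / ‖w + d‖ ≤ w.im / ‖w‖ := div_le_div_of_nonneg_left hy h0 hn
    exact mul_nonneg hy (sub_nonneg.2 (Real.monotone_arcsin this))
  · have h1 : -w.im / ‖w + d‖ ≤ -w.im / ‖w‖ := div_le_div_of_nonneg_left (by linarith) h0 hn
    rw [neg_div, neg_div, neg_le_neg_iff] at h1
    exact mul_nonneg_of_nonpos_of_nonpos hy.le (sub_nonpos.2 (Real.monotone_arcsin h1))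

/-- **The logarithmic terms**: `(Re w − ½)(log‖w‖ − log‖w+d‖) ≤ d/(2x₀)` for `Re w ≥ x₀ > 0`, `d ≥ 0`. -/
theorem re_mul_log_sub_log_le {w : ℂ} {x₀ d : ℝ} (hx₀ : 0 < x₀) (hw : x₀ ≤ w.re) (hd : 0 ≤ d) :
    (w.re - 1 / 2) * (Real.log ‖w‖ - Real.log ‖w + d‖) ≤ d / (2 * x₀) := by
  have hw0 : 0 < w.re := lt_of_lt_of_le hx₀ hw
  have hn0 : 0 < ‖w‖ := lt_of_lt_of_le hw0 (Complex.re_le_norm w)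
  have hx₀n : x₀ ≤ ‖w‖ := le_trans hw (Complex.re_le_norm w)
  have hn : ‖w‖ ≤ ‖w + d‖ := norm_le_norm_add_ofReal hw0.le hd
  have hnd : 0 < ‖w + d‖ := lt_of_lt_of_le hn0 hn
  have hlog0 : Real.log ‖w‖ ≤ Real.log ‖w + d‖ := Real.log_le_log hn0 hn
  -- `log‖w+d‖ − log‖w‖ ≤ d/‖w‖ ≤ d/x₀`
  have hlog1 : Real.log ‖w + d‖ - Real.log ‖w‖ ≤ d / x₀ := by
    rw [← Real.log_div hnd.ne' hn0.ne']
    have h1 := Real.log_le_sub_one_of_pos (div_pos hnd hn0)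
    have h2 : ‖w + d‖ / ‖w‖ - 1 ≤ d / ‖w‖ := by
      rw [div_sub_one hn0.ne', div_le_div_iff_of_pos_right hn0]
      linarith [norm_add_ofReal_le w hd]
    have h3 : d / ‖w‖ ≤ d / x₀ := div_le_div_of_nonneg_left hd hx₀ hx₀n
    linarith
  have hdx : 0 ≤ d / x₀ := div_nonneg hd hx₀.le
  rcases le_or_gt (1 / 2) w.re with h | h
  · calc (w.re - 1 / 2) * (Real.log ‖w‖ - Real.log ‖w + d‖) ≤ 0 :=
          mul_nonpos_of_nonneg_of_nonpos (by linarith) (by linarith)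
      _ ≤ d / (2 * x₀) := by positivity
  · have : (w.re - 1 / 2) * (Real.log ‖w‖ - Real.log ‖w + d‖) = (1 / 2 - w.re) * (Real.log ‖w + d‖ - Real.log ‖w‖) := by ring
    rw [this]
    calc (1 / 2 - w.re) * (Real.log ‖w + d‖ - Real.log ‖w‖) ≤ (1 / 2) * (d / x₀) :=
          mul_le_mul (by linarith) hlog1 (by linarith) (by norm_num)
      _ = d / (2 * x₀) := by field_simp

/-! ### 2. The uniform ratio bound -/

/-- **Uniform vertical ratio bound** [Stirling; Whittaker–Watson §13.6, Titchmarsh (4.12.3), here UNIFORM in the real part]: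
for `x₀ > 0` and `d ≥ 0` there is `C > 0` with `‖Γ(w)‖ ≤ C · ‖w + d‖^{−d} · ‖Γ(w + d)‖` for every `w` with `Re w ≥ x₀`
(explicitly `C = exp(d/(2x₀) + d + (1/6)(1/x₀² + π/(2x₀)))`). -/
theorem exists_norm_Gamma_le_rpow_mul {x₀ d : ℝ} (hx₀ : 0 < x₀) (hd : 0 ≤ d) :
    ∃ C : ℝ, 0 < C ∧ ∀ w : ℂ, x₀ ≤ w.re →
      ‖Complex.Gamma w‖ ≤ C * ‖w + d‖ ^ (-d) * ‖Complex.Gamma (w + d)‖ := by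
  set e₀ : ℝ := (1 / 12) * (1 / x₀ ^ 2 + π / (2 * x₀)) with he₀
  refine ⟨Real.exp (d / (2 * x₀) + d + 2 * e₀), Real.exp_pos _, fun w hw => ?_⟩
  have hw0 : 0 < w.re := lt_of_lt_of_le hx₀ hw
  have hwd : 0 < (w + d).re := by simp; linarith
  have hΓ1 : Complex.Gamma w ≠ 0 := Complex.Gamma_ne_zero_of_re_pos hw0
  have hΓ2 : Complex.Gamma (w + d) ≠ 0 := Complex.Gamma_ne_zero_of_re_pos hwd
  have hn1 : x₀ ≤ ‖w‖ := le_trans hw (Complex.re_le_norm w)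
  have hn2 : x₀ ≤ ‖w + d‖ := le_trans (by simp; linarith : x₀ ≤ (w + d).re) (Complex.re_le_norm _)
  have hnd : 0 < ‖w + d‖ := lt_of_lt_of_le hx₀ hn2
  -- the Stirling errors are bounded by `e₀` on `Re ≥ x₀`
  have herr : ∀ z : ℂ, x₀ ≤ ‖z‖ → (1 / 12) * (1 / ‖z‖ ^ 2 + π / (2 * ‖z‖)) ≤ e₀ := by
    intro z hz
    have hz0 : 0 < ‖z‖ := lt_of_lt_of_le hx₀ hz
    have h1 : 1 / ‖z‖ ^ 2 ≤ 1 / x₀ ^ 2 := by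
      apply div_le_div_of_nonneg_left zero_le_one (by positivity)
      exact pow_le_pow_left₀ hx₀.le hz 2
    have h2 : π / (2 * ‖z‖) ≤ π / (2 * x₀) := div_le_div_of_nonneg_left Real.pi_pos.le (by positivity) (by linarith)
    rw [he₀]; linarith
  have h1 := abs_log_norm_Gamma_sub_le hw0
  have h2 := abs_log_norm_Gamma_sub_le hwd
  rw [abs_le] at h1 h2
  have e1 := herr w hn1
  have e2 := herr (w + d) hn2
  simp only [Complex.add_re, Complex.ofReal_re, Complex.add_im, Complex.ofReal_im, add_zero] at h2
  have hlog := re_mul_log_sub_log_le hx₀ hw hd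
  have harg := im_mul_arg_sub_arg_nonneg hw0 hd
  -- `log‖Γ w‖ ≤ log‖Γ(w+d)‖ − d log‖w+d‖ + K`
  have key : Real.log ‖Complex.Gamma w‖ ≤
      Real.log ‖Complex.Gamma (w + d)‖ + Real.log ‖w + d‖ * (-d) + (d / (2 * x₀) + d + 2 * e₀) := by
    nlinarith [h1.2, h2.1, e1, e2, hlog, harg]
  calc ‖Complex.Gamma w‖ = Real.exp (Real.log ‖Complex.Gamma w‖) := (Real.exp_log (norm_pos_iff.2 hΓ1)).symm
    _ ≤ Real.exp (Real.log ‖Complex.Gamma (w + d)‖ + Real.log ‖w + d‖ * (-d) + (d / (2 * x₀) + d + 2 * e₀)) :=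
        Real.exp_le_exp.2 key
    _ = Real.exp (d / (2 * x₀) + d + 2 * e₀) * ‖w + d‖ ^ (-d) * ‖Complex.Gamma (w + d)‖ := by
        rw [Real.exp_add, Real.exp_add, Real.exp_log (norm_pos_iff.2 hΓ2), Real.rpow_def_of_pos hnd]
        ring

/-- Ratio form: `‖Γ(w)/Γ(w+d)‖ ≤ C ‖w+d‖^{−d}` for `Re w ≥ x₀`. -/
theorem exists_norm_Gamma_div_le {x₀ d : ℝ} (hx₀ : 0 < x₀) (hd : 0 ≤ d) :
    ∃ C : ℝ, 0 < C ∧ ∀ w : ℂ, x₀ ≤ w.re → ‖Complex.Gamma w / Complex.Gamma (w + d)‖ ≤ C * ‖w + d‖ ^ (-d) := by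
  obtain ⟨C, hC, h⟩ := exists_norm_Gamma_le_rpow_mul hx₀ hd
  refine ⟨C, hC, fun w hw => ?_⟩
  have hΓ2 : Complex.Gamma (w + d) ≠ 0 := Complex.Gamma_ne_zero_of_re_pos (by simp; linarith)
  rw [norm_div, div_le_iff₀ (norm_pos_iff.2 hΓ2)]
  exact h w hw

/-- **The shape met in the induction step**: conjugate ordinate in the numerator.  For `x₀ > 0`, `d ≥ 0` there is `C > 0` with
`‖Γ(x − iy)/Γ(x + d + iy)‖ ≤ C ‖x + d + iy‖^{−d}` for all real `x ≥ x₀` and `y` (since `‖Γ(x − iy)‖ = ‖Γ(x + iy)‖`). -/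
theorem exists_norm_Gamma_conj_div_le {x₀ d : ℝ} (hx₀ : 0 < x₀) (hd : 0 ≤ d) :
    ∃ C : ℝ, 0 < C ∧ ∀ x y : ℝ, x₀ ≤ x →
      ‖Complex.Gamma ((x : ℂ) - (y : ℂ) * Complex.I) / Complex.Gamma ((x : ℂ) + d + (y : ℂ) * Complex.I)‖ ≤
        C * ‖(x : ℂ) + d + (y : ℂ) * Complex.I‖ ^ (-d) := by
  obtain ⟨C, hC, h⟩ := exists_norm_Gamma_le_rpow_mul hx₀ hd
  refine ⟨C, hC, fun x y hx => ?_⟩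
  have hconj : (x : ℂ) - (y : ℂ) * Complex.I = (starRingEnd ℂ) ((x : ℂ) + (y : ℂ) * Complex.I) := by
    apply Complex.ext <;> simp
  have hΓ2 : Complex.Gamma ((x : ℂ) + d + (y : ℂ) * Complex.I) ≠ 0 := Complex.Gamma_ne_zero_of_re_pos (by simp; linarith)
  have hw : x₀ ≤ ((x : ℂ) + (y : ℂ) * Complex.I).re := by simp [hx]
  have hwd : ((x : ℂ) + (y : ℂ) * Complex.I) + d = (x : ℂ) + d + (y : ℂ) * Complex.I := by ring
  have := h _ hw
  rw [hwd] at this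
  rw [norm_div, div_le_iff₀ (norm_pos_iff.2 hΓ2), hconj, Complex.Gamma_conj, Complex.norm_conj]
  exact this

end Summit.KontsevichZagierPeriods.Zeta5Search.GammaRatioUniform

end
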